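import Summits.BirchSwinnertonDyer.BirchSwinnertonDyer.Theses.PrintX9
import Literature.NumberTheory.EllipticCurves.HeegnerPointsOfConductorOneGaloisConjProofs
import Literature.NumberTheory.EllipticCurves.HeegnerPointsOfConductorOneRationalityProofs
import Literature.NumberTheory.EllipticCurves.MatarNekovar2019.IrreducibleOverQuadraticFieldProofs
import Literature.NumberTheory.EllipticCurves.NeronIsogenyScalingHoldsProofs
import Literature.NumberTheory.EllipticCurves.YanZhu2026.BDPMainConjectureRationalAtTrivialCharacter
import HarnessLib

/-!
# Route `PrintX9`, support item `HeegnerPrintFactsX9` (stmt-BirchSwinnertonDyer-20530): the SLIMMED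
# dependency list — the twelve-conjunct Heegner-side print pack from EIGHT irredundant inputs

D-0154 (2) INPUTS→UNCONDITIONAL, `INPUTS-LIST-2.md` §4 T1 «PackSlim» (cell `pub/bsd-wall`, seat
`bsd-inputs-pack-p1`). `HeegnerPrintFactsX9` is the conjunction of the twelve HEEGNER-side published
facts the X9 leaf kernel consumes: Gross–Zagier over `K`; Kolyvagin over `K`; Galois descent of the
conductor-`1` Heegner point; Shimura reciprocity `φ(τ) ∈ E(H_K)`; Cha 2005 Rmk 25; Matar–Nekovář 2019
Prop 5.26 (2); BCS 2025 Thm 1.2.4 (a) + Prop 4.2.2 ∘ CGLS 5.1.3; JSW 2017 Thm 3.3.1; newform existence;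
Hoffstein–Luo 1997; Mazur 1978 Cor. 4.1; Néron-scaling integrality. FOUR of the twelve are THEOREMS
of the tree:

* conjunct 3 (Darmon 2004 Thm 3.7 / Gross 1991 §4): `heegnerPointOfConductor_one_galoisConj_holds`
  (`HeegnerPointsOfConductorOneGaloisConjProofs.lean`);
* conjunct 4 (Darmon 2004 Thm 3.6): `phi_heegnerTau_mem_singularModuliField_holds`
  (`HeegnerPointsOfConductorOneRationalityProofs.lean`);
* conjunct 6 (Matar–Nekovář 2019 Prop 5.26 (2), the route's CLOSED item 20533):
  `MatarNekovar2019.prop526_hasIrreducibleModPGaloisRep_baseChange_holds`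
  (`MatarNekovar2019/IrreducibleOverQuadraticFieldProofs.lean`);
* conjunct 12 (Néron-scaling integrality, the route's CLOSED item 20536):
  `integral_neronScaling_of_isGloballyMinimal_holds` (`NeronIsogenyScalingHoldsProofs.lean`);

and conjunct 7 (the BCS composite, item 20534 `BCSAnticyclotomicGeneratorConstantCoeff`) also follows
from the strictly stronger Yan–Zhu 2026 Thm 5.7 (1) composite
`YanZhu2026.thm57_bcs422_cgls513_generator_constantCoeff` (route PrintX10b's item 21210) by
`BurungaleCastellaSkinner2025.thm124a_prop422_thm513_generator_constantCoeff_of_thm57`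
(`YanZhu2026/BDPMainConjectureRationalAtTrivialCharacter.lean`).

Theorems: `heegnerPrintFactsX9_of_slim` — the pack from EIGHT inputs (Gross–Zagier, Kolyvagin, and the
route items `ChaStructureUpperHalf` 19934, `BCSAnticyclotomicGeneratorConstantCoeff` 20534,
`JSWAnticyclotomicControl` 20535, `NewformExistence` 19382, `HoffsteinLuoTwistNonvanishing` 19372,
`MazurManinConstantOdd` 19383); `heegnerPrintFactsX9_of_slim_thm57` — the same with the BCS composite
fed from the Yan–Zhu composite. HONEST FRAMING: pure glue over landed theorems; no cite-only fact is
proved here; the eight remaining inputs (Gross–Zagier–Kolyvagin among them) stay print hypotheses and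
the route stays conditional on them AS TYPED. Nothing here proves BSD; BSD is not proved by any of this.
-/

set_option autoImplicit false
set_option linter.dupNamespace false

namespace Summit.BirchSwinnertonDyer.BirchSwinnertonDyer.Theorems

open Literature.NumberTheory.EllipticCurves
open Summit.BirchSwinnertonDyer.BirchSwinnertonDyer.Theses.PrintX9

/-- **`HeegnerPrintFactsX9` from eight irredundant inputs** (route `PrintX9`, item
stmt-BirchSwinnertonDyer-20530; INPUTS-LIST-2 T1): Gross–Zagier and Kolyvagin over `K` (conjuncts 1–2,
verbatim), Cha 2005 Rmk 25 (`ChaStructureUpperHalf`), the BCS anticyclotomic generator composite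
(`BCSAnticyclotomicGeneratorConstantCoeff`), JSW 2017 Thm 3.3.1 (`JSWAnticyclotomicControl`), the
Modularity Theorem (`NewformExistence`), Hoffstein–Luo 1997 (`HoffsteinLuoTwistNonvanishing`) and
Mazur 1978 Cor. 4.1 (`MazurManinConstantOdd`) imply the twelve-conjunct pack: conjuncts 3, 4, 6, 12 are
the tree theorems `heegnerPointOfConductor_one_galoisConj_holds`,
`phi_heegnerTau_mem_singularModuliField_holds`,
`MatarNekovar2019.prop526_hasIrreducibleModPGaloisRep_baseChange_holds`,
`integral_neronScaling_of_isGloballyMinimal_holds`. Pure glue; the eight hypotheses remain print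
inputs. [folklore] -/
theorem heegnerPrintFactsX9_of_slim
    (hGZ : ∀ (N : ℕ) [NeZero N] (W : WeierstrassCurve ℚ) (K : Type) [Field K] [NumberField K],
      gross_zagier N W K)
    (hKoly : ∀ (N : ℕ) [NeZero N] (W : WeierstrassCurve ℚ) (K : Type) [Field K] [NumberField K],
      kolyvagin N W K)
    (hCha : ChaStructureUpperHalf) (hBCS : BCSAnticyclotomicGeneratorConstantCoeff)
    (hJSW : JSWAnticyclotomicControl) (hmod : NewformExistence)
    (hHL : HoffsteinLuoTwistNonvanishing) (hMazur : MazurManinConstantOdd) :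
    Summit.BirchSwinnertonDyer.BirchSwinnertonDyer.Theses.PrintX9.HeegnerPrintFactsX9 :=
  ⟨hGZ, hKoly,
    fun N _ W K _ _ => heegnerPointOfConductor_one_galoisConj_holds N W K,
    fun N _ W K _ _ => phi_heegnerTau_mem_singularModuliField_holds N W K,
    hCha, MatarNekovar2019.prop526_hasIrreducibleModPGaloisRep_baseChange_holds, hBCS, hJSW, hmod,
    hHL, hMazur, integral_neronScaling_of_isGloballyMinimal_holds⟩

/-- **`HeegnerPrintFactsX9` with the BCS composite fed from the Yan–Zhu composite**: as
`heegnerPrintFactsX9_of_slim`, but conjunct 7 (BCS 2025 Thm 1.2.4 (a) + Prop 4.2.2 ∘ CGLS 5.1.3, item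
20534) is supplied from the strictly stronger `YanZhu2026.thm57_bcs422_cgls513_generator_constantCoeff`
(Yan–Zhu Thm 5.7 (1) ∘ BCS Prop 4.2.2 ∘ CGLS 5.1.3 — route PrintX10b's item 21210) by the tree theorem
`BurungaleCastellaSkinner2025.thm124a_prop422_thm513_generator_constantCoeff_of_thm57`; so the two
Heegner packs of X9 and X10b rest on ONE anticyclotomic composite. Pure glue. [folklore] -/
theorem heegnerPrintFactsX9_of_slim_thm57
    (hGZ : ∀ (N : ℕ) [NeZero N] (W : WeierstrassCurve ℚ) (K : Type) [Field K] [NumberField K],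
      gross_zagier N W K)
    (hKoly : ∀ (N : ℕ) [NeZero N] (W : WeierstrassCurve ℚ) (K : Type) [Field K] [NumberField K],
      kolyvagin N W K)
    (hCha : ChaStructureUpperHalf) (h57 : YanZhu2026.thm57_bcs422_cgls513_generator_constantCoeff)
    (hJSW : JSWAnticyclotomicControl) (hmod : NewformExistence)
    (hHL : HoffsteinLuoTwistNonvanishing) (hMazur : MazurManinConstantOdd) :
    Summit.BirchSwinnertonDyer.BirchSwinnertonDyer.Theses.PrintX9.HeegnerPrintFactsX9 :=
  heegnerPrintFactsX9_of_slim hGZ hKoly hCha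
    (BurungaleCastellaSkinner2025.thm124a_prop422_thm513_generator_constantCoeff_of_thm57 h57)
    hJSW hmod hHL hMazur

/-- **The cross-route edge as an item implication**: the Yan–Zhu composite
`YanZhu2026.thm57_bcs422_cgls513_generator_constantCoeff` gives the route item
`BCSAnticyclotomicGeneratorConstantCoeff` (20534). [folklore] -/
theorem bcsAnticyclotomicGeneratorConstantCoeff_of_thm57
    (h57 : YanZhu2026.thm57_bcs422_cgls513_generator_constantCoeff) :
    Summit.BirchSwinnertonDyer.BirchSwinnertonDyer.Theses.PrintX9.BCSAnticyclotomicGeneratorConstantCoeff :=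
  BurungaleCastellaSkinner2025.thm124a_prop422_thm513_generator_constantCoeff_of_thm57 h57

end Summit.BirchSwinnertonDyer.BirchSwinnertonDyer.Theorems
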